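import Mathlib
import HarnessLib
import Literature.MathematicalPhysics.StatisticalMechanics.AbkmPackageShrink

/-!
# [ABKM19] — the two-kernel `S_k` slots of Lemma 12.6 (12.53) LOCALISED in the tuning parameter
# (`ℓ = 1, 2`; `N`-free sizes on a neighbourhood of the diagonal; named `Prop`s only)

[ABKM19] (Adams–Buchholz–Kotecký–Müller, arXiv:1910.13564) Lemma 12.6 (12.53) / Lemma 8.4 compare the irrelevant
RG step `S_k^{(q)}(u, v)` of Theorem 6.8 for two (at `ℓ = 2`: four) tuning parameters `q` in the ball
`Σ|q_ij| ≤ T₀`.  The genuinely analytic content — the Banach-grade two-kernel comparison of the two polymer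
expansions with the per-connected-polymer pair property of Lemma 8.4 — is LOCAL in `q`: it is needed, and the
comparison kernels `𝒞_{1+q',k+1} = (1 + O(|q'−q|₁))𝒞_{1+q,k+1}` are available, only for `|q' − q|₁ ≤ T₁` with a
threshold `T₁ > 0` depending on the package but NOT on the height `N` of the torus; in the far field
`|q' − q|₁ > T₁` the slots follow from the zeroth-order bound `‖S_k^{(q)}(u,v)‖_{k+1} ≤ σ(r)·max(‖u‖, ‖v‖_k)` of
Theorem 6.8 alone (twice at `ℓ = 1`; at `ℓ = 2` from the `ℓ = 1` slot twice).  This file only NAMES the localised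
slots, in the vocabulary of `AbkmPackageSlots` (`PackageData`, `PackageAt`, `Q.opS`, `P.InBall`, `esum`,
`activityNormLE`), with the sizes AND the thresholds bound BEFORE `∀ N`:

* `F4lLoc P Q l_T T₁` — slot (F4l) (`‖S_q(u,v) − S_q'(u,v)‖_{k+1} ≤ l_T |q−q'|₁ max(‖u‖, ‖v‖_k)` on the state
  ball of radius `P.r`) restricted to `|q − q'|₁ ≤ T₁`;
* `F4l2Loc P Q l_TT T₂` — slot (F4l2) (mixed second `q`-differences on parallelograms `q, q+y, q+z, q+y+z` in
  the ball) restricted to `|y|₁ ≤ T₂`, `|z|₁ ≤ T₂`;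
* `TwoKernelSkBoundLoc d` — for every package an `N`-free pair `(l_T, T₁)`, `T₁ > 0`, with `F4lLoc` at every
  height (the local form of `TwoKernelSkBound d`);
* `F4l2ShrinkLoc d` — for every package an `N`-free pair `(l_TT, T₂)`, `T₂ > 0`, with `F4l2Loc` for the SHRUNK
  package `P.shrink` (state corners in the `P.r/8`-ball, `AbkmPackageShrink`) at every height (the local form of
  `F4l2Shrink d` of `AbkmPackageShrunkSlots`).

The global slots follow from the local ones and Theorem 6.8 by the far-field argument above (done Summits-side,
where they are consumed).  Use (honest scope): vocabulary for the child `TwoKernelSkBound` of the cruxes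
`HypACumulant` / `HypALocalTwoPoint` of the rung route `Summits/HubbardSuperconductivity/…/Theses/ComplexGFFStiffness`
(rung H2gff / 1c: volume-uniform stiffness of a complex Gaussian gradient field via the [ABKM19] renormalisation
group); nothing about superconductivity in the Hubbard model is claimed or advanced here.  Definitions only;
NOTHING in this file is asserted.

## References
* S. Adams, S. Buchholz, R. Kotecký, S. Müller, *Cauchy–Born rule from microscopic models with non-convex
  potentials*, arXiv:1910.13564 — Thm 6.8, Lemma 8.4, Lemma 12.6 (12.51)–(12.53), Ch. 12 (12.4)
  [AdamsBuchholzKoteckyMuller2019].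
* S. Buchholz, *Finite range decomposition for Gaussian measures with improved regularity*, J. Funct. Anal.
  275 (2018) 1674–1711, Thm 2.4 / Thm 4.5 [Buchholz2016].
-/

noncomputable section

namespace Literature.MathematicalPhysics.StatisticalMechanics.GradientRG

/-! ## The localised slots (free size and threshold) -/

section Slots

variable {d : ℕ} (P : PackageData d) [Fact (0 < P.h)] [Fact (0 < P.L)] {N M : ℕ} [NeZero M]
  (Q : PackageAt P N M)

/-- **(F4l-loc)** the `S_k` two-kernel comparison (12.53) in the tuning parameter — verbatim the slot `F4l P Q l_T`
of `AbkmPackageSlots` (state ball of radius `P.r`, all steps `k + 1 ≤ N`) RESTRICTED to pairs `q, q'` of the ball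
with `|q − q'|₁ ≤ T₁`:
`‖S_q(u,v) − S_q'(u,v)‖_{k+1} ≤ l_T · |q − q'|₁ · max(‖u‖, ‖v‖_k)`.
[cite: AdamsBuchholzKoteckyMuller2019, Lemma 12.6 (12.53)] -/
def F4lLoc (lT T₁ : ℝ) : Prop :=
  ∀ q q' : Matrix (Fin d) (Fin d) ℝ, P.InBall q → P.InBall q' → esum (q - q') ≤ T₁ → ∀ k, k + 1 ≤ N →
    ∀ (u : HamSpace ℂ d (fieldWt P.h (P.L : ℝ) d k) ((P.L : ℝ) ^ k) (P.L ^ (d * k)))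
      (v : activitySpace Q.normParams k) (cv : ℝ), ‖u‖ ≤ P.r →
      activityNormLE Q.normParams k v cv → cv ≤ P.r →
      activityNormLE Q.normParams (k + 1) (Q.opS q k u v - Q.opS q' k u v)
        (lT * esum (q - q') * max ‖u‖ cv)

/-- **(F4l2-loc)** mixed second differences of `q ↦ S_q(u, v)` in the activity norm (`ℓ = 2` of (12.53)) —
verbatim the slot `F4l2 P Q l_TT` of `AbkmPackageSlots` RESTRICTED to parallelograms `q, q+y, q+z, q+y+z` of the
ball with SHORT sides `|y|₁ ≤ T₂`, `|z|₁ ≤ T₂`: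
`‖S_{q+y+z}(u,v) − S_{q+y}(u,v) − S_{q+z}(u,v) + S_q(u,v)‖_{k+1} ≤ l_TT · |y|₁ |z|₁ · max(‖u‖, ‖v‖_k)`.
[cite: AdamsBuchholzKoteckyMuller2019, Lemma 8.4 / Lemma 12.6 (12.53)] -/
def F4l2Loc (lTT T₂ : ℝ) : Prop :=
  ∀ q y z : Matrix (Fin d) (Fin d) ℝ, P.InBall q → P.InBall (q + y) → P.InBall (q + z) →
    P.InBall (q + y + z) → esum y ≤ T₂ → esum z ≤ T₂ → ∀ k, k + 1 ≤ N →
    ∀ (u : HamSpace ℂ d (fieldWt P.h (P.L : ℝ) d k) ((P.L : ℝ) ^ k) (P.L ^ (d * k)))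
      (v : activitySpace Q.normParams k) (cv : ℝ), ‖u‖ ≤ P.r →
      activityNormLE Q.normParams k v cv → cv ≤ P.r →
      activityNormLE Q.normParams (k + 1)
        (Q.opS (q + y + z) k u v - Q.opS (q + y) k u v - Q.opS (q + z) k u v + Q.opS q k u v)
        (lTT * esum y * esum z * max ‖u‖ cv)

end Slots

/-! ## The named local bundles (sizes and thresholds bound BEFORE `∀ N`) -/

/-- **`TwoKernelSkBoundLoc d`** — the LOCAL form of `TwoKernelSkBound d`: for every [ABKM19] package `P` an
`N`-FREE size `l_T ≥ 0` and an `N`-FREE threshold `T₁ > 0` with (F4l-loc) at every height `N`, i.e. the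
Banach-grade two-kernel comparison of `S_k` for tuning parameters at `|·|₁`-distance at most `T₁` (where the
comparison kernel `𝒞_{1+q',k+1}` is a small multiplicative perturbation of `𝒞_{1+q,k+1}` and the pair property of
Lemma 8.4 holds per connected polymer); the far field is Theorem 6.8.
[cite: AdamsBuchholzKoteckyMuller2019, Lemma 12.6 (12.53) / Thm 6.8] -/
def TwoKernelSkBoundLoc (d : ℕ) : Prop :=
  ∀ (P : PackageData d) [Fact (0 < P.h)] [Fact (0 < P.L)],
    ∃ lT T₁ : ℝ, 0 ≤ lT ∧ 0 < T₁ ∧ ∀ (N M : ℕ) [NeZero M] (Q : PackageAt P N M), F4lLoc P Q lT T₁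

/-- **`F4l2ShrinkLoc d`** — the LOCAL form of `F4l2Shrink d`: for every [ABKM19] package `P` an `N`-FREE size
`l_TT ≥ 0` and an `N`-FREE threshold `T₂ > 0` with (F4l2-loc) for the SHRUNK package `P.shrink` (state corners in
the `P.r/8`-ball, Theorem 6.8 available on the `P.r`-ball) at every height `N` — the second-order two-kernel
comparison of `S_k` on short parallelograms; long parallelograms reduce to (F4l) twice.
[cite: AdamsBuchholzKoteckyMuller2019, Lemma 8.4 / Lemma 12.6 (12.53)] -/
def F4l2ShrinkLoc (d : ℕ) : Prop :=
  ∀ (P : PackageData d) [Fact (0 < P.h)] [Fact (0 < P.L)],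
    ∃ lTT T₂ : ℝ, 0 ≤ lTT ∧ 0 < T₂ ∧
      ∀ (N M : ℕ) [NeZero M] (Q : PackageAt P.shrink N M), F4l2Loc P.shrink Q lTT T₂

/-! ## Appendix (2026-08-31, line `banach_two_kernel`): the same local slot at the level of the RAW step map

The package slot `F4lLoc` measures `Q.opS q k u v − Q.opS q' k u v`, where `Q.opS` (`rgSQ`) is the admissible-activity
wrapper `restrictConn ∘ nextKStep (abkmStepData …) ∘ (toHam, mulExt)` on the Theorem-6.8 ball.  The two-kernel twins
of the Theorem-6.8 contraction files produce the bound one level lower, for the RAW renormalisation map `nextKStep` of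
[ABKM19] Definition 6.5 (6.34) in the weak norm of scale `k + 1`; the passage to `F4lLoc` is plumbing
(`coe_rgSQ_of_mem`, `restrictConn`).  The corresponding local slot and bundle: -/

section RawSlots

variable {d : ℕ} (P : PackageData d) [Fact (0 < P.h)] [Fact (0 < P.L)] {N M : ℕ} [NeZero M]
  (Q : PackageAt P N M)

/-- **(F4l-loc, raw)** the two-kernel comparison (12.53) for the RAW step map: for `q, q'` in the ball with
`|q − q'|₁ ≤ T₁`, `k + 1 ≤ N`, `‖u‖ ≤ P.r`, `‖v‖_k ≤ c_v ≤ P.r`, the weak norm at scale `k + 1` of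
`K_{k+1}^{(q)} − K_{k+1}^{(q')}`, `K_{k+1}^{(q)} = nextKStep (abkmStepData L R k 𝒞_{1+q,·}) (toHam u) (mulExt v)`, is at most
`l_N · |q − q'|₁ · max(‖u‖, c_v)`. [cite: AdamsBuchholzKoteckyMuller2019, Lemma 12.6 (12.53) / Definition 6.5 (6.34)] -/
def F4lRawLoc (lN T₁ : ℝ) : Prop :=
  ∀ q q' : Matrix (Fin d) (Fin d) ℝ, P.InBall q → P.InBall q' → esum (q - q') ≤ T₁ → ∀ k, k + 1 ≤ N →
    ∀ (u : HamSpace ℂ d (fieldWt P.h (P.L : ℝ) d k) ((P.L : ℝ) ^ k) (P.L ^ (d * k)))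
      (v : activitySpace Q.normParams k) (cv : ℝ), ‖u‖ ≤ P.r →
      activityNormLE Q.normParams k v cv → cv ≤ P.r →
      WeakNormLE Q.normParams (k + 1)
        (fun U φ =>
          nextKStep (abkmStepData P.L P.R k (Q.kernels q)) (HamSpace.toHam u)
              (mulExt ((v : activitySpace Q.normParams k) :
                Finset (Fin d → ZMod M) → ((Fin d → ZMod M) → ℝ) → ℂ)) U φ -
            nextKStep (abkmStepData P.L P.R k (Q.kernels q')) (HamSpace.toHam u)
              (mulExt ((v : activitySpace Q.normParams k) :
                Finset (Fin d → ZMod M) → ((Fin d → ZMod M) → ℝ) → ℂ)) U φ)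
        (lN * esum (q - q') * max ‖u‖ cv)

end RawSlots

/-- **`TwoKernelNextKStepLoc d`** — `TwoKernelSkBoundLoc d` one level lower: for every [ABKM19] package an `N`-FREE
size `l_N ≥ 0` and threshold `T₁ > 0` with (F4l-loc, raw) at every height — the honest output of the Banach-grade
two-kernel comparison of the raw step map `nextKStep` (linear part: `PackageData.exists_weakNormLE_opC_sub`;
remainders: two-kernel twins of the Theorem-6.8 remainder files). [cite: AdamsBuchholzKoteckyMuller2019, Lemma 12.6 (12.53) / Thm 6.8] -/
def TwoKernelNextKStepLoc (d : ℕ) : Prop :=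
  ∀ (P : PackageData d) [Fact (0 < P.h)] [Fact (0 < P.L)],
    ∃ lN T₁ : ℝ, 0 ≤ lN ∧ 0 < T₁ ∧ ∀ (N M : ℕ) [NeZero M] (Q : PackageAt P N M), F4lRawLoc P Q lN T₁

end Literature.MathematicalPhysics.StatisticalMechanics.GradientRG

end
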